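/-
Copyright (c) 2026 the pub-hodgecm-mathlib formalisation cell (harness21).  Prover seat hodgecm-mathlib-LH4-p19 (g2), req620 Track A «(D-RAM) FOUR-FRAME» squad
(STAGE-1b, row (2) of the piece `f_{T₊}`, the (β₂) road (R-36) «PURE-CELL LEDGER»; β₂ sub-dealer LH4-p04 (g9) BETA2-BOARD v2 row (ROW-D♭), dealt by name; the assembled
count of the diagonal cell: in every `T`-class the affine label is balanced), 2026-09-04.
-/
import Summits.HodgeConjecture.HodgeConjecture.Theorems.F0P3cDyRamDiagonalCellDigitMap          -- ★ (this seat, K6b): the digit map; brings ★ K5b (fibre transport), ★ K5c (generator independence), ★ K3, ★ K5a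
import Summits.HodgeConjecture.HodgeConjecture.Theorems.F0P3cDyRamDiagonalCellDigitBalance      -- ★ p862913 (this seat, K6a): `card_filter_lit_affine_eq`; brings ★ p862250 `card_filter_eq_card_filter_not_of_fibre_const`
import HarnessLib

/-!
# Crux `H413`, line LH4 «(D-RAM) FOUR-FRAME» — STAGE-1b, row (2), the (β₂) road (R-36), lane B, row (ROW-D♭), THE COUNT ASSEMBLED — «IN EVERY `T`-CLASS OF THE DIAGONAL CELL
# THE AFFINE LABEL IS BALANCED»: `#{Λ ∈ D ∣ cls(T_Λ) = ε ∧ ω_σ(α₁ + γ₁V_Λ) = 1} = #{Λ ∈ D ∣ cls(T_Λ) = ε ∧ ω_σ(α₁ + γ₁V_Λ) ≠ 1}`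

Cell `hodgecm-mathlib` (D-0151), FLOOR 0, crux item H413 = `stmt-HodgeConjecture-24833`, route of record `HCCMUnconditional`; squad F0∕P3c∕LH4; lane
`--supports stmt-HodgeConjecture-24833 --as helper` (count-neutral; pays NO tier-0 row).  THEOREMS ONLY (no `def`, no instance, no notation, no `sorry`, default heartbeats);
★-only imports; states NO law; (β₂) stays a HYPOTHESIS.  DATUM-FREE two-field letters: `E` (with `σ`, the sheet datum `IsRamifiedQuadraticDatum σ ϖ d t`, digit systems
`R_d`, `R′`, the affine letters `α₁, γ₁` of ★ p862875), `M` (with `ρ`, `Θ`, the RamK datum `IsRamifiedQuadraticDatum Θ (jE ϖ) d t_M`, `α`, `h`, a pivot `θ₀`), `jE : E → M`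
isometric onto `Fix ρ` with `Θ ∘ jE = jE ∘ σ`; `hFN` («doubly fixed units are `Θ`-norms») is a binder as in ★ p862758; the cell is `D = levelSet ρ Θ α (jE ϖ) h b b` (★ DEFS).

WHY (memo MECH-LDflat §2–§4; this seat's K1–K6).  Row (ROW-D♭) of the β₂-board — `cellDiff_t(m∕2, m∕2) = 0` for `2 ≤ δ ≤ 2d − 2` — is, lattice by lattice, the statement that
among the POPULATED lattices of the diagonal cell (those whose `T = Tr_ρ ŵ(x₀)` lies in a prescribed `σ`-norm class `ε`) the label `+` and the label `−` are equinumerous; by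
★ p862875 the label of `Λ` is `ω_σ(T̂)·ω_σ(α₁ + γ₁V)`, `V = Tr_ρ(θ₀ŵ)∕Tr_ρ ŵ`, so on a `T`-class it is the AFFINE LABEL `ω_σ(α₁ + γ₁V)` up to a constant sign.  THIS FILE
proves the affine label balanced on every `T`-class of `D`: §1 is the abstract fibration argument (the populated class `S` maps to the literal digits `B ⊆ R_d` by
`Λ ↦ digit(V_Λ)` — well defined by ★ K5c, into `B` by ★ K6b §2 — with fibres of one size (★ K5b) and the label a function of the digit (★ K6b §3); ★ p862250 then transfers
the digit balance ★ p862913 to `S`), §2 instantiates it with the cell.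
* §1 `ncard_eq_ncard_of_digit_fibration` — ABSTRACT: generator data `GEN`, class `CLS`, coordinate `Vf`, digits `R_d`, literal `LIT`, label `ψ`; independence, preimages,
  literal digits, label transfer, equal literal fibres, finiteness and digit balance ⇒ `#{GEN ∧ (CLS ↔ ε) ∧ ψ} = #{GEN ∧ (CLS ↔ ε) ∧ ¬ψ}`.
* §2 HEAD `ncard_cls_affine_eq_ncard_cls_not_affine` — the diagonal cell: `#{Λ ∣ ∃ x₀ gen, (cls T(x₀) ↔ ε) ∧ ω_σ(α₁ + γ₁V̂(x₀)) = 1} = #{… ∧ ω_σ(α₁ + γ₁V̂(x₀)) ≠ 1}`.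
WHAT IS NOT CLAIMED: the bridge to the canonical cone-ledger labels `q±` of `beta2ConesB.letter.v2` (POP ⟺ `cls T = ε₀` via ★ K3 `glueUnit_mul_eq_neg_trace`; LAB via
★ p862875; the shells), i.e. row (ROW-D♭) in letter bytes; the regime `2 ≤ δ ≤ 2d − 2` enters only there (through `1 ≤ g`, `g + 1 ≤ d` of the affine letters).
HONEST LABEL.  Count-neutral lattice bookkeeping; nothing printed is asserted; no census law is stated; `HC_CM` is proved only modulo the 7 printed citations (2 remaining named
inputs: hLiu418 = `stmt-HodgeConjecture-24832`, h413 = `stmt-HodgeConjecture-24833`) until rung 0 closes.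
## References
* [Kottwitz1986BaseChangeUnits] R. E. Kottwitz, *Base change for unit elements of Hecke algebras*, Compositio Math. 60 (1986): §1 pp. 240–241 (fixed-lattice counts).
* [Flicker1998UnitaryFL] Y. Z. Flicker, *Elementary proof of the fundamental lemma for a unitary group*, Canad. J. Math. 50 (1998): Prop. 7 p. 84 (type RamK census).
* [LabesseLanglands1979] J.-P. Labesse, R. P. Langlands, *L-indistinguishability for SL(2)*, Canad. J. Math. 31 (1979): §2 (2.2) p. 9 (κ-signed counts).
* [Serre1979] J.-P. Serre, *Local Fields*, GTM 67 (1979): Ch. V §3 Cor. 3 pp. 85–87, Ch. XV §2 (norm classes).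
* [Jacobowitz1962] R. Jacobowitz, *Hermitian forms over local fields*, Amer. J. Math. 84 (1962): §4 (dual lattices, gluing).
* [Rogawski1990] J. D. Rogawski, *Automorphic Representations of Unitary Groups in Three Variables*, Ann. of Math. Stud. 123 (1990): §4.9 Prop. 4.9.1 (b) p. 55, §12.2.
-/

set_option autoImplicit false

noncomputable section

namespace Summit.HodgeConjecture.HodgeConjecture.Cruxes.H413.F0P3cDyRamDiagonalCellBalancedCount

open scoped Valued WithZero Classical
open WithZero Finset
open Literature.NumberTheory.Automorphic.UnitaryThreeFourFrame (IsRamifiedQuadraticDatum normSign normSign_of_isNorm normSign_of_not_isNorm)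
open Literature.NumberTheory.LocalFields.WildQuadraticDatum (exists_mul_map_eq_of_fixed_of_v_sub_one_le_pred)
open Summit.HodgeConjecture.HodgeConjecture.Cruxes.H413.F0P3cDyRamToricCensusDefs
open Summit.HodgeConjecture.HodgeConjecture.Cruxes.H413.F0P3cDyRamFourFramePieces (mstarOfRecord)
open Summit.HodgeConjecture.HodgeConjecture.Cruxes.H413.F0P3cDyRamCellBalanceOfFibreHalving (card_filter_eq_card_filter_not_of_fibre_const)
open Summit.HodgeConjecture.HodgeConjecture.Cruxes.H413.F0P3cDyRamDiagonalCellGeneratorIndependence (coords_letters_of_gen cls_iff_cls_and_v_sub_le_of_presentations)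
open Summit.HodgeConjecture.HodgeConjecture.Cruxes.H413.F0P3cDyRamDiagonalCellFibreTransport (ncard_fibre_eq_ncard_fibre)
open Summit.HodgeConjecture.HodgeConjecture.Cruxes.H413.F0P3cDyRamDiagonalCellDigitMap (normSign_hatw_div_eq_of_near exists_mul_map_eq_hatwV_div
  normSign_affineLabel_eq_of_near exists_preimage_of_fixed)
open Summit.HodgeConjecture.HodgeConjecture.Cruxes.H413.F0P3cDyRamDiagonalCellDigitBalance (card_filter_lit_affine_eq)

variable {E M : Type} [Field E] [Valued E ℤᵐ⁰] [Field M] [Valued M ℤᵐ⁰] {σ : E →+* E} {ρ Θ : M →+* M} {ϖ : E} {d t : ℕ}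

/-! ## §1 The abstract fibration argument -/

/-- **BALANCE OF A DIGIT-DETERMINED LABEL ON A CLASS OF THE CELL (abstract).**  Lattices `Λ : X` carry generator data `GEN Λ x₀` (`x₀ : M`), a class `CLS x₀` and a coordinate
`Vf x₀ : M`; `jE : E → M` is isometric; `R_d ⊆ E` is complete (for `σ`-fixed integers) and irredundant modulo `|·| ≤ r`; `LIT`, `ψ` are predicates on digits.  IF (hI) class and
coordinate do not depend on the generator (`|Vf x₀′ − Vf x₀| ≤ r`), (hP) every coordinate is `jE` of a `σ`-fixed integer, (hL) every digit within `r` of a coordinate is literal,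
(hψ) `ψ` is constant on digit classes, (hF) the fibres `{∃ x₀, GEN ∧ (CLS ↔ ε) ∧ |Vf x₀ − jE y| ≤ r}` over literal digits `y` all have the same size, the cell is finite, and (hbase)
`ψ` is balanced on the literal digits — THEN `#{Λ ∣ ∃ x₀, GEN ∧ (CLS ↔ ε) ∧ ∃ V̂, jE V̂ = Vf x₀ ∧ ψ V̂} = #{… ∧ ¬ψ V̂}` (★ p862250 `card_filter_eq_card_filter_not_of_fibre_const` for
the digit map `Λ ↦ digit`). [cite: Kottwitz1986BaseChangeUnits, §1 pp. 240–241] [cite: LabesseLanglands1979, §2 (2.2) p. 9] -/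
theorem ncard_eq_ncard_of_digit_fibration {X : Type} (GEN : X → M → Prop) (CLS : M → Prop) (Vf : M → M) (ε : Prop)
    (jE : E →+* M) (hjiso : ∀ a, Valued.v (jE a) = Valued.v a) (r : ℤᵐ⁰)
    (Rd : Finset E) (hRd2 : ∀ V : E, σ V = V → Valued.v V ≤ 1 → ∃ V₀ ∈ Rd, Valued.v (V - V₀) ≤ r)
    (hRd3 : ∀ V ∈ Rd, ∀ V' ∈ Rd, Valued.v (V - V') ≤ r → V = V')
    (LIT ψ : E → Prop) [DecidablePred LIT] [DecidablePred ψ]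
    (hI : ∀ (Λ : X) (x₀ x₀' : M), GEN Λ x₀ → GEN Λ x₀' → (CLS x₀ ↔ CLS x₀') ∧ Valued.v (Vf x₀' - Vf x₀) ≤ r)
    (hP : ∀ (Λ : X) (x₀ : M), GEN Λ x₀ → ∃ Ve : E, jE Ve = Vf x₀ ∧ σ Ve = Ve ∧ Valued.v Ve ≤ 1)
    (hL : ∀ (Λ : X) (x₀ : M) (V₀ : E), GEN Λ x₀ → V₀ ∈ Rd → Valued.v (Vf x₀ - jE V₀) ≤ r → LIT V₀)
    (hψ : ∀ Ve V₀ : E, σ Ve = Ve → Valued.v Ve ≤ 1 → V₀ ∈ Rd → Valued.v (Ve - V₀) ≤ r → (ψ Ve ↔ ψ V₀))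
    (hF : ∀ y ∈ Rd.filter LIT, ∀ y' ∈ Rd.filter LIT,
      {Λ : X | ∃ x₀, GEN Λ x₀ ∧ (CLS x₀ ↔ ε) ∧ Valued.v (Vf x₀ - jE y) ≤ r}.ncard =
        {Λ : X | ∃ x₀, GEN Λ x₀ ∧ (CLS x₀ ↔ ε) ∧ Valued.v (Vf x₀ - jE y') ≤ r}.ncard)
    (hfin : {Λ : X | ∃ x₀, GEN Λ x₀}.Finite)
    (hbase : ((Rd.filter LIT).filter ψ).card = ((Rd.filter LIT).filter fun V => ¬ ψ V).card) :
    {Λ : X | ∃ x₀, GEN Λ x₀ ∧ (CLS x₀ ↔ ε) ∧ ∃ Ve : E, jE Ve = Vf x₀ ∧ ψ Ve}.ncard =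
      {Λ : X | ∃ x₀, GEN Λ x₀ ∧ (CLS x₀ ↔ ε) ∧ ∃ Ve : E, jE Ve = Vf x₀ ∧ ¬ ψ Ve}.ncard := by
  set B : Finset E := Rd.filter LIT with hB
  -- the digit of a lattice: a literal digit within `r` of a coordinate
  have hdig : ∀ Λ : X, (∃ x₀, GEN Λ x₀) → ∃ V₀ ∈ B, ∃ x₀, GEN Λ x₀ ∧ Valued.v (Vf x₀ - jE V₀) ≤ r := by
    rintro Λ ⟨x₀, hG⟩
    obtain ⟨Ve, hjVe, hσVe, hVe1⟩ := hP Λ x₀ hG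
    obtain ⟨V₀, hV₀R, hnear⟩ := hRd2 Ve hσVe hVe1
    have hnearM : Valued.v (Vf x₀ - jE V₀) ≤ r := by rw [← hjVe, ← map_sub, hjiso]; exact hnear
    exact ⟨V₀, mem_filter.2 ⟨hV₀R, hL Λ x₀ V₀ hG hV₀R hnearM⟩, x₀, hG, hnearM⟩
  choose! π hπB hπnear using hdig
  -- the digit is unique: for any generator, `|Vf x₀ − jE V₀| ≤ r ↔ π Λ = V₀`
  have hπuniq : ∀ (Λ : X) (x₀ : M) (V₀ : E), GEN Λ x₀ → V₀ ∈ Rd → (Valued.v (Vf x₀ - jE V₀) ≤ r ↔ π Λ = V₀) := by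
    intro Λ x₀ V₀ hG hV₀R
    obtain ⟨x₁, hG₁, h₁⟩ := hπnear Λ ⟨x₀, hG⟩
    have hI₁ : Valued.v (Vf x₁ - Vf x₀) ≤ r := (hI Λ x₀ x₁ hG hG₁).2
    have hπR : π Λ ∈ Rd := (mem_filter.1 (hπB Λ ⟨x₀, hG⟩)).1
    constructor
    · intro h0
      refine hRd3 _ hπR _ hV₀R ?_
      rw [← hjiso, map_sub]
      have e : jE (π Λ) - jE V₀ = (Vf x₀ - jE V₀) - (Vf x₁ - jE (π Λ)) + (Vf x₁ - Vf x₀) := by ring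
      rw [e]
      exact (Valuation.map_add _ _ _).trans (max_le ((Valuation.map_sub _ _ _).trans (max_le h0 h₁)) hI₁)
    · rintro rfl
      have e : Vf x₀ - jE (π Λ) = (Vf x₁ - jE (π Λ)) - (Vf x₁ - Vf x₀) := by ring
      rw [e]
      exact (Valuation.map_sub _ _ _).trans (max_le h₁ hI₁)
  -- the populated class `S` as a finite set
  set S : Finset X := hfin.toFinset.filter (fun Λ => ∃ x₀, GEN Λ x₀ ∧ (CLS x₀ ↔ ε)) with hS
  have hmemS : ∀ Λ, Λ ∈ S ↔ ∃ x₀, GEN Λ x₀ ∧ (CLS x₀ ↔ ε) := by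
    intro Λ
    rw [hS, mem_filter, Set.Finite.mem_toFinset, Set.mem_setOf_eq]
    exact ⟨fun hh => hh.2, fun hh => ⟨(by obtain ⟨x₀, hG, -⟩ := hh; exact ⟨x₀, hG⟩), hh⟩⟩
  have hSB : ∀ Λ ∈ S, π Λ ∈ B := fun Λ hΛ => by
    obtain ⟨x₀, hG, -⟩ := (hmemS Λ).1 hΛ
    exact hπB Λ ⟨x₀, hG⟩
  -- the fibres of `π` over the digits are the `∃`-fibres
  have hcardfib : ∀ y ∈ Rd, (S.filter fun Λ => π Λ = y).card = {Λ : X | ∃ x₀, GEN Λ x₀ ∧ (CLS x₀ ↔ ε) ∧ Valued.v (Vf x₀ - jE y) ≤ r}.ncard := by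
    intro y hy
    have hset : ((S.filter fun Λ => π Λ = y) : Set X) = {Λ : X | ∃ x₀, GEN Λ x₀ ∧ (CLS x₀ ↔ ε) ∧ Valued.v (Vf x₀ - jE y) ≤ r} := by
      ext Λ
      simp only [coe_filter, Set.mem_setOf_eq, hmemS]
      constructor
      · rintro ⟨⟨x₀, hG, hC⟩, hπ⟩
        exact ⟨x₀, hG, hC, (hπuniq Λ x₀ y hG hy).2 hπ⟩
      · rintro ⟨x₀, hG, hC, hn⟩
        exact ⟨⟨x₀, hG, hC⟩, (hπuniq Λ x₀ y hG hy).1 hn⟩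
    rw [← hset, Set.ncard_coe_finset]
  -- the fibres over the literal digits have one size `k`
  obtain ⟨k, hk⟩ : ∃ k : ℕ, ∀ y ∈ B, (S.filter fun Λ => π Λ = y).card = k := by
    by_cases hBne : B.Nonempty
    · obtain ⟨y₀, hy₀⟩ := hBne
      refine ⟨(S.filter fun Λ => π Λ = y₀).card, fun y hy => ?_⟩
      rw [hcardfib y (mem_filter.1 hy).1, hcardfib y₀ (mem_filter.1 hy₀).1]
      exact hF y hy y₀ hy₀
    · exact ⟨0, fun y hy => absurd ⟨y, hy⟩ hBne⟩
  -- the abstract balance on `S`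
  have hbal := card_filter_eq_card_filter_not_of_fibre_const S π B hSB k hk ψ hbase
  -- identify the two sides: the label of a lattice is the label of its digit
  have hside : ∀ (φ : E → Prop) [DecidablePred φ], (∀ Ve V₀ : E, σ Ve = Ve → Valued.v Ve ≤ 1 → V₀ ∈ Rd → Valued.v (Ve - V₀) ≤ r → (φ Ve ↔ φ V₀)) →
      ((S.filter fun Λ => φ (π Λ)) : Set X) = {Λ : X | ∃ x₀, GEN Λ x₀ ∧ (CLS x₀ ↔ ε) ∧ ∃ Ve : E, jE Ve = Vf x₀ ∧ φ Ve} := by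
    intro φ _ hφ
    ext Λ
    simp only [coe_filter, Set.mem_setOf_eq, hmemS]
    constructor
    · rintro ⟨⟨x₀, hG, hC⟩, hφπ⟩
      obtain ⟨Ve, hjVe, hσVe, hVe1⟩ := hP Λ x₀ hG
      have hπR : π Λ ∈ Rd := (mem_filter.1 (hπB Λ ⟨x₀, hG⟩)).1
      have hnear : Valued.v (Ve - π Λ) ≤ r := by
        rw [← hjiso, map_sub, hjVe]; exact (hπuniq Λ x₀ (π Λ) hG hπR).2 rfl
      exact ⟨x₀, hG, hC, Ve, hjVe, (hφ Ve (π Λ) hσVe hVe1 hπR hnear).2 hφπ⟩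
    · rintro ⟨x₀, hG, hC, Ve, hjVe, hφVe⟩
      have hπR : π Λ ∈ Rd := (mem_filter.1 (hπB Λ ⟨x₀, hG⟩)).1
      obtain ⟨Ve', hjVe', hσVe, hVe1⟩ := hP Λ x₀ hG
      have hVV : Ve' = Ve := jE.injective (by rw [hjVe', hjVe])
      rw [hVV] at hσVe hVe1
      have hnear : Valued.v (Ve - π Λ) ≤ r := by
        rw [← hjiso, map_sub, hjVe]; exact (hπuniq Λ x₀ (π Λ) hG hπR).2 rfl
      exact ⟨⟨x₀, hG, hC⟩, (hφ Ve (π Λ) hσVe hVe1 hπR hnear).1 hφVe⟩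
  rw [← hside ψ hψ, ← hside (fun V => ¬ ψ V) (fun Ve V₀ h1 h2 h3 h4 => not_congr (hψ Ve V₀ h1 h2 h3 h4)),
    Set.ncard_coe_finset, Set.ncard_coe_finset]
  exact hbal

/-! ## §2 HEAD — in every `T`-class of the diagonal cell the affine label is balanced -/

/-- **HEAD — «IN EVERY `T`-CLASS OF THE DIAGONAL CELL THE AFFINE LABEL IS BALANCED».**  E-side: a complete sheet datum `IsRamifiedQuadraticDatum σ ϖ d t`, finite residue field,
`|2| < 1`; `σ`-fixed `α₁, γ₁` with `|α₁| = 1`, `|γ₁| = |ϖ|^{2g}`, `1 ≤ g`, `g + 1 ≤ d`; digit systems `R_d` (mod `|·| ≤ |ϖ|^{2d}`), `R′` (mod `|·| ≤ |ϖ|^{2(d−g)}`).  M-side: `ρ`, `Θ`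
commuting isometric involutions with the RamK datum `IsRamifiedQuadraticDatum Θ (jE ϖ) d t_M` (complete, finite residue field, `|2| < 1`), `hFN`, a `Θ`-fixed pivot `θ₀` (`|θ₀| ≤ 1`,
`|θ₀ − ρθ₀| = 1`), `|α − ρα| = 1`, `|α| ≤ 1`, `|α − Θα| < 1`, `Θh = h`, `d ≤ b`, `m* ≤ 2b`; `jE` isometric onto `Fix ρ` with `Θ ∘ jE = jE ∘ σ`; `ε : Prop`; the cell
`levelSet ρ Θ α (jE ϖ) h b b` finite.  With `ŵ(x₀) = (ν·h·x₀Θx₀)⁻¹`, `ν = (α − ρα)Θ(α − ρα)`, `T(x₀) = Tr_ρ ŵ(x₀)`, `V(x₀) = Tr_ρ(θ₀ŵ(x₀))∕T(x₀)`: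
`#{Λ ∣ ∃ x₀ ≠ 0, Λ = x₀·𝒪_b ∧ IsOrd Y ∧ ¬IsOrd(Y∕jEϖ) ∧ |Y| = |jEϖ|^b ∧ ((∃ c, ρc = c ∧ cΘc = T(x₀)) ↔ ε) ∧ ∃ V̂, jE V̂ = V(x₀) ∧ ω_σ(α₁ + γ₁V̂) = 1}`
`= #{… ∧ ∃ V̂, jE V̂ = V(x₀) ∧ ω_σ(α₁ + γ₁V̂) ≠ 1}` (`Y = dualGen`).  §1 with ★ K5c (hI), ★ K6b (hP, hL, hψ), ★ K5b (hF, `eΘe` from two literal digits), ★ p862913 (hbase).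
[cite: Kottwitz1986BaseChangeUnits, §1 pp. 240–241] [cite: Flicker1998UnitaryFL, Prop. 7 p. 84] [cite: LabesseLanglands1979, §2 (2.2) p. 9] [cite: Serre1979, Ch. XV §2] -/
theorem ncard_cls_affine_eq_ncard_cls_not_affine [CompleteSpace E] [Finite 𝓀[E]] [CompleteSpace M] [Finite 𝓀[M]]
    (hD : IsRamifiedQuadraticDatum σ ϖ d t) (h2v : Valued.v (2 : E) < 1)
    {α₁ γ₁ : E} (hσα : σ α₁ = α₁) (hα1 : Valued.v α₁ = 1) (hσγ : σ γ₁ = γ₁) {g : ℕ} (hγ : Valued.v γ₁ = Valued.v ϖ ^ (2 * g)) (hg1 : 1 ≤ g) (hgd : g + 1 ≤ d)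
    (Rd : Finset E) (hRd1 : ∀ V ∈ Rd, σ V = V ∧ Valued.v V ≤ 1)
    (hRd2 : ∀ V : E, σ V = V → Valued.v V ≤ 1 → ∃ V₀ ∈ Rd, Valued.v (V - V₀) ≤ Valued.v ϖ ^ (2 * d))
    (hRd3 : ∀ V ∈ Rd, ∀ V' ∈ Rd, Valued.v (V - V') ≤ Valued.v ϖ ^ (2 * d) → V = V')
    (R' : Finset E) (hR'1 : ∀ V ∈ R', σ V = V ∧ Valued.v V ≤ 1)
    (hR'2 : ∀ V : E, σ V = V → Valued.v V ≤ 1 → ∃ V₀ ∈ R', Valued.v (V - V₀) ≤ Valued.v ϖ ^ (2 * (d - g)))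
    (hR'3 : ∀ V ∈ R', ∀ V' ∈ R', Valued.v (V - V') ≤ Valued.v ϖ ^ (2 * (d - g)) → V = V')
    (jE : E →+* M) (hjiso : ∀ a, Valued.v (jE a) = Valued.v a) (hjfix : ∀ z : M, ρ z = z ↔ ∃ a, jE a = z) (hΘj : ∀ a, Θ (jE a) = jE (σ a))
    {tM : ℕ} (hDM : IsRamifiedQuadraticDatum Θ (jE ϖ) d tM) (h2M : Valued.v (2 : M) < 1)
    (hρρ : ∀ x, ρ (ρ x) = x) (hvρ : ∀ x, Valued.v (ρ x) = Valued.v x) (hΘρ : ∀ x, Θ (ρ x) = ρ (Θ x))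
    (hFN : ∀ f : M, ρ f = f → Θ f = f → Valued.v f = 1 → ∃ z : M, z * Θ z = f)
    {θ₀ : M} (hΘθ₀ : Θ θ₀ = θ₀) (hθ1 : Valued.v θ₀ ≤ 1) (hθρ : Valued.v (θ₀ - ρ θ₀) = 1)
    {α : M} (hαρ1 : Valued.v (α - ρ α) = 1) (hα1M : Valued.v α ≤ 1) (hram : Valued.v (α - Θ α) < 1) {h : M} (hΘh : Θ h = h)
    {b : ℕ} (hdb : d ≤ b) (hmb : mstarOfRecord d ≤ 2 * b) (ε : Prop) (hfin : (levelSet ρ Θ α (jE ϖ) h b b).Finite) :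
    {Λ : AddSubgroup M | ∃ x₀ : M, (x₀ ≠ 0 ∧ (∀ x, x ∈ Λ ↔ ∃ ζ, IsOrd ρ α (jE ϖ ^ b) ζ ∧ x = x₀ * ζ) ∧
        IsOrd ρ α (jE ϖ ^ b) (dualGen ρ Θ α (jE ϖ ^ b) h x₀) ∧ ¬ IsOrd ρ α (jE ϖ ^ b) (dualGen ρ Θ α (jE ϖ ^ b) h x₀ / jE ϖ) ∧
        Valued.v (dualGen ρ Θ α (jE ϖ ^ b) h x₀) = Valued.v (jE ϖ) ^ b) ∧
      ((∃ c : M, ρ c = c ∧ c * Θ c = (((α - ρ α) * Θ (α - ρ α)) * (h * (x₀ * Θ x₀)))⁻¹ + ρ (((α - ρ α) * Θ (α - ρ α)) * (h * (x₀ * Θ x₀)))⁻¹) ↔ ε) ∧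
      ∃ Ve : E, jE Ve = (θ₀ * (((α - ρ α) * Θ (α - ρ α)) * (h * (x₀ * Θ x₀)))⁻¹ + ρ (θ₀ * (((α - ρ α) * Θ (α - ρ α)) * (h * (x₀ * Θ x₀)))⁻¹)) /
          ((((α - ρ α) * Θ (α - ρ α)) * (h * (x₀ * Θ x₀)))⁻¹ + ρ (((α - ρ α) * Θ (α - ρ α)) * (h * (x₀ * Θ x₀)))⁻¹) ∧
        normSign σ (α₁ + γ₁ * Ve) = 1}.ncard =
    {Λ : AddSubgroup M | ∃ x₀ : M, (x₀ ≠ 0 ∧ (∀ x, x ∈ Λ ↔ ∃ ζ, IsOrd ρ α (jE ϖ ^ b) ζ ∧ x = x₀ * ζ) ∧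
        IsOrd ρ α (jE ϖ ^ b) (dualGen ρ Θ α (jE ϖ ^ b) h x₀) ∧ ¬ IsOrd ρ α (jE ϖ ^ b) (dualGen ρ Θ α (jE ϖ ^ b) h x₀ / jE ϖ) ∧
        Valued.v (dualGen ρ Θ α (jE ϖ ^ b) h x₀) = Valued.v (jE ϖ) ^ b) ∧
      ((∃ c : M, ρ c = c ∧ c * Θ c = (((α - ρ α) * Θ (α - ρ α)) * (h * (x₀ * Θ x₀)))⁻¹ + ρ (((α - ρ α) * Θ (α - ρ α)) * (h * (x₀ * Θ x₀)))⁻¹) ↔ ε) ∧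
      ∃ Ve : E, jE Ve = (θ₀ * (((α - ρ α) * Θ (α - ρ α)) * (h * (x₀ * Θ x₀)))⁻¹ + ρ (θ₀ * (((α - ρ α) * Θ (α - ρ α)) * (h * (x₀ * Θ x₀)))⁻¹)) /
          ((((α - ρ α) * Θ (α - ρ α)) * (h * (x₀ * Θ x₀)))⁻¹ + ρ (((α - ρ α) * Θ (α - ρ α)) * (h * (x₀ * Θ x₀)))⁻¹) ∧
        ¬ normSign σ (α₁ + γ₁ * Ve) = 1}.ncard := by
  -- letters
  have hΘΘ : ∀ x, Θ (Θ x) = x := hDM.1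
  have hvΘ : ∀ x, Valued.v (Θ x) = Valued.v x := hDM.2.1
  have hϖM : Valued.v (jE ϖ) = exp (-1 : ℤ) := hDM.2.2.1
  have hd1 : 1 ≤ d := hDM.2.2.2.2.2.1
  have hb1 : 1 ≤ b := le_trans hd1 hdb
  have hρϖ : ρ (jE ϖ) = jE ϖ := (hjfix _).2 ⟨ϖ, rfl⟩
  have hr : Valued.v (jE ϖ) ^ (2 * d) = Valued.v ϖ ^ (2 * d) := by rw [hjiso]
  have hϖlt : Valued.v ϖ < 1 := by rw [hD.2.2.1, ← exp_zero, exp_lt_exp]; norm_num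
  have hγ1 : Valued.v γ₁ < 1 := by rw [hγ]; exact pow_lt_one₀ zero_le hϖlt (by omega)
  -- the deep letter through `jE`: doubly fixed units `≡ 1 (ϖ^{2d})` are `Θ`-norms of `ρ`-fixed elements
  have hdeep : ∀ u : M, ρ u = u → Θ u = u → Valued.v (u - 1) ≤ Valued.v (jE ϖ) ^ (2 * d) → ∃ c : M, ρ c = c ∧ c * Θ c = u := by
    intro u hρu hΘu hu1
    obtain ⟨ue, rfl⟩ := (hjfix u).1 hρu
    have hσue : σ ue = ue := jE.injective (by rw [← hΘj, hΘu])
    have hue1 : Valued.v (ue - 1) ≤ Valued.v ϖ ^ (2 * d) := by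
      rw [← hjiso, map_sub, map_one, ← hr]; exact hu1
    obtain ⟨z, hz⟩ := exists_mul_map_eq_of_fixed_of_v_sub_one_le_pred hD hσue (n := 2 * d) (by omega) hue1
    exact ⟨jE z, (hjfix _).2 ⟨z, rfl⟩, by rw [hΘj, ← map_mul, hz]⟩
  -- an empty cell has nothing to count; otherwise fix a reference generator `xr` and `c = ŵ(xr)`
  by_cases hne : ∃ (Λ : AddSubgroup M) (x₀ : M), x₀ ≠ 0 ∧ (∀ x, x ∈ Λ ↔ ∃ ζ, IsOrd ρ α (jE ϖ ^ b) ζ ∧ x = x₀ * ζ) ∧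
      IsOrd ρ α (jE ϖ ^ b) (dualGen ρ Θ α (jE ϖ ^ b) h x₀) ∧ ¬ IsOrd ρ α (jE ϖ ^ b) (dualGen ρ Θ α (jE ϖ ^ b) h x₀ / jE ϖ) ∧
      Valued.v (dualGen ρ Θ α (jE ϖ ^ b) h x₀) = Valued.v (jE ϖ) ^ b
  swap
  · have e : ∀ φ : E → Prop, {Λ : AddSubgroup M | ∃ x₀ : M, (x₀ ≠ 0 ∧ (∀ x, x ∈ Λ ↔ ∃ ζ, IsOrd ρ α (jE ϖ ^ b) ζ ∧ x = x₀ * ζ) ∧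
        IsOrd ρ α (jE ϖ ^ b) (dualGen ρ Θ α (jE ϖ ^ b) h x₀) ∧ ¬ IsOrd ρ α (jE ϖ ^ b) (dualGen ρ Θ α (jE ϖ ^ b) h x₀ / jE ϖ) ∧
        Valued.v (dualGen ρ Θ α (jE ϖ ^ b) h x₀) = Valued.v (jE ϖ) ^ b) ∧
      ((∃ c : M, ρ c = c ∧ c * Θ c = (((α - ρ α) * Θ (α - ρ α)) * (h * (x₀ * Θ x₀)))⁻¹ + ρ (((α - ρ α) * Θ (α - ρ α)) * (h * (x₀ * Θ x₀)))⁻¹) ↔ ε) ∧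
      ∃ Ve : E, jE Ve = (θ₀ * (((α - ρ α) * Θ (α - ρ α)) * (h * (x₀ * Θ x₀)))⁻¹ + ρ (θ₀ * (((α - ρ α) * Θ (α - ρ α)) * (h * (x₀ * Θ x₀)))⁻¹)) /
          ((((α - ρ α) * Θ (α - ρ α)) * (h * (x₀ * Θ x₀)))⁻¹ + ρ (((α - ρ α) * Θ (α - ρ α)) * (h * (x₀ * Θ x₀)))⁻¹) ∧ φ Ve} = ∅ :=
      fun φ => Set.eq_empty_iff_forall_notMem.2 fun Λ ⟨x₀, hG, _⟩ => hne ⟨Λ, x₀, hG⟩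
    rw [e (fun Ve => normSign σ (α₁ + γ₁ * Ve) = 1), e (fun Ve => ¬ normSign σ (α₁ + γ₁ * Ve) = 1)]
  obtain ⟨Λr, xr, hGr⟩ := hne
  have hxr : xr ≠ 0 := hGr.1
  obtain ⟨-, hc1, hΘc, -⟩ := coords_letters_of_gen hρρ hvρ hΘΘ hΘρ hvΘ hαρ1 hram hΘh hρϖ hϖM hΘθ₀ hθ1 hθρ hb1 hGr.2.2.2.1 hGr.2.2.2.2
  have hc0 : (((α - ρ α) * Θ (α - ρ α)) * (h * (xr * Θ xr)))⁻¹ ≠ 0 := fun h0 => by rw [h0, map_zero] at hc1; exact zero_ne_one hc1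
  -- §1 for the cell
  refine ncard_eq_ncard_of_digit_fibration
    (fun (Λ : AddSubgroup M) (x₀ : M) => x₀ ≠ 0 ∧ (∀ x, x ∈ Λ ↔ ∃ ζ, IsOrd ρ α (jE ϖ ^ b) ζ ∧ x = x₀ * ζ) ∧
      IsOrd ρ α (jE ϖ ^ b) (dualGen ρ Θ α (jE ϖ ^ b) h x₀) ∧ ¬ IsOrd ρ α (jE ϖ ^ b) (dualGen ρ Θ α (jE ϖ ^ b) h x₀ / jE ϖ) ∧
      Valued.v (dualGen ρ Θ α (jE ϖ ^ b) h x₀) = Valued.v (jE ϖ) ^ b)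
    (fun x₀ : M => ∃ c : M, ρ c = c ∧ c * Θ c = (((α - ρ α) * Θ (α - ρ α)) * (h * (x₀ * Θ x₀)))⁻¹ + ρ (((α - ρ α) * Θ (α - ρ α)) * (h * (x₀ * Θ x₀)))⁻¹)
    (fun x₀ : M => (θ₀ * (((α - ρ α) * Θ (α - ρ α)) * (h * (x₀ * Θ x₀)))⁻¹ + ρ (θ₀ * (((α - ρ α) * Θ (α - ρ α)) * (h * (x₀ * Θ x₀)))⁻¹)) /
          ((((α - ρ α) * Θ (α - ρ α)) * (h * (x₀ * Θ x₀)))⁻¹ + ρ (((α - ρ α) * Θ (α - ρ α)) * (h * (x₀ * Θ x₀)))⁻¹))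
    ε jE hjiso (Valued.v (jE ϖ) ^ (2 * d)) Rd (fun V hσV hV1 => by rw [hr]; exact hRd2 V hσV hV1)
    (fun V hV V' hV' hle => hRd3 V hV V' hV' (by rw [← hr]; exact hle))
    (fun V₀ : E => normSign Θ ((jE V₀ - ρ θ₀) / (θ₀ - ρ θ₀) / (((α - ρ α) * Θ (α - ρ α)) * (h * (xr * Θ xr)))⁻¹) = 1)
    (fun V : E => normSign σ (α₁ + γ₁ * V) = 1)
    (fun Λ x₀ x₀' hG hG' => ?_) (fun Λ x₀ hG => ?_) (fun Λ x₀ V₀ hG hV₀R hnear => ?_) (fun Ve V₀ hσVe hVe1 hV₀R hnear => ?_)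
    (fun y hy y' hy' => ?_) hfin ?_
  · -- (hI) generator independence, ★ K5c
    exact cls_iff_cls_and_v_sub_le_of_presentations hρρ hvρ hΘΘ hΘρ hvΘ hαρ1 hα1M hram hΘh hρϖ hDM hΘθ₀ hθ1 hθρ hdb hmb hdeep
      hG.1 hG.2.1 hG'.2.1 hG.2.2.2.1 hG.2.2.2.2
  · -- (hP) an `E`-side preimage of `V(x₀)`
    obtain ⟨-, -, -, -, -, -, hρV, hΘV, hV1, -⟩ := coords_letters_of_gen hρρ hvρ hΘΘ hΘρ hvΘ hαρ1 hram hΘh hρϖ hϖM hΘθ₀ hθ1 hθρ hb1 hG.2.2.2.1 hG.2.2.2.2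
    exact exists_preimage_of_fixed jE hjiso hjfix hΘj hρV hΘV hV1
  · -- (hL) every digit is literal
    obtain ⟨-, -, -, -, -, -, hρV, hΘV, hV1, -⟩ := coords_letters_of_gen hρρ hvρ hΘΘ hΘρ hvΘ hαρ1 hram hΘh hρϖ hϖM hΘθ₀ hθ1 hθρ hb1 hG.2.2.2.1 hG.2.2.2.2
    have hΘY' : Θ (jE V₀) = jE V₀ := by rw [hΘj, (hRd1 V₀ hV₀R).1]
    rw [normSign_hatw_div_eq_of_near hρρ hvρ hΘρ hDM hΘθ₀ hθ1 hθρ _ hρV hΘV hV1 hΘY' (by rw [Valuation.map_sub_swap]; exact hnear)]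
    exact normSign_of_isNorm Θ (exists_mul_map_eq_hatwV_div hρρ hvρ hΘΘ hΘρ hvΘ hαρ1 hram hΘh hρϖ hϖM hΘθ₀ hθ1 hθρ hb1 hFN hG.1 hxr hG.2.2.2.1 hG.2.2.2.2)
  · -- (hψ) the affine label is constant on digit classes
    have hnear' : Valued.v (V₀ - Ve) ≤ Valued.v ϖ ^ (2 * d) := by rw [Valuation.map_sub_swap, ← hr]; exact hnear
    rw [normSign_affineLabel_eq_of_near hD hσα hα1 hσγ hγ1 hσVe hVe1 (hRd1 V₀ hV₀R).1 hnear']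
  · -- (hF) the literal fibres have one size, ★ K5b with `eΘe = ŵ(jE y)∕ŵ(jE y′)` from the two literal digits
    obtain ⟨hyR, hyL⟩ := mem_filter.1 hy
    obtain ⟨hy'R, hy'L⟩ := mem_filter.1 hy'
    have hnorm : ∀ {x : M}, normSign Θ x = 1 → ∃ z : M, z * Θ z = x := fun {x} hx => by
      by_contra hno
      have h1 := normSign_of_not_isNorm Θ hno
      rw [hx] at h1
      exact absurd h1 (by norm_num)
    obtain ⟨z, hz⟩ := hnorm hyL
    obtain ⟨z', hz'⟩ := hnorm hy'L
    have he : z / z' * Θ (z / z') = (jE y - ρ θ₀) / (θ₀ - ρ θ₀) / ((jE y' - ρ θ₀) / (θ₀ - ρ θ₀)) := by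
      rw [map_div₀, div_mul_div_comm, hz, hz', div_div_div_cancel_right₀ hc0]
    have hρy : ρ (jE y) = jE y := (hjfix _).2 ⟨y, rfl⟩
    have hρy' : ρ (jE y') = jE y' := (hjfix _).2 ⟨y', rfl⟩
    have hΘy : Θ (jE y) = jE y := by rw [hΘj, (hRd1 y hyR).1]
    have hΘy' : Θ (jE y') = jE y' := by rw [hΘj, (hRd1 y' hy'R).1]
    have hy1 : Valued.v (jE y) ≤ 1 := by rw [hjiso]; exact (hRd1 y hyR).2
    have hy'1 : Valued.v (jE y') ≤ 1 := by rw [hjiso]; exact (hRd1 y' hy'R).2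
    have hF := ncard_fibre_eq_ncard_fibre hρρ hvρ hΘΘ hΘρ hvΘ hαρ1 hram hΘh hρϖ hϖM hΘθ₀ hθ1 hθρ hb1 hd1 hdeep hρy hΘy hy1 hρy' hΘy' hy'1 he ε hfin
    simpa only [and_assoc] using hF
  · -- (hbase) the affine label is balanced on the literal digits, ★ p862913
    exact card_filter_lit_affine_eq hD h2v hσα hα1 hσγ hγ hg1 hgd Rd hRd1 hRd2 hRd3 R' hR'1 hR'2 hR'3 jE hjiso hjfix hΘj hDM h2M hρρ hvρ hΘρ hFN hΘθ₀ hθ1 hθρ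
      hΘc hc1

end Summit.HodgeConjecture.HodgeConjecture.Cruxes.H413.F0P3cDyRamDiagonalCellBalancedCount

end
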